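import Mathlib
import Summits.KontsevichZagierPeriods.Statement
import Summits.KontsevichZagierPeriods.KontsevichZagierPeriods.Theses.TerasomaMultiplication
import Summits.KontsevichZagierPeriods.KontsevichZagierPeriods.Theses.MotivatedMoves
import Summits.KontsevichZagierPeriods.KontsevichZagierPeriods.Theses.CompiledSubstitutions

/-!
# Crux GammaHodgeSector (stmt-KontsevichZagierPeriods-3742) — ideator-3 sketch (round 1)

First lemmas of two crux idea cards; every `def … : Prop` elaborates, nothing is proved here
except the shape-glue `tetrahedralGapTwelve_of` (how the engine + the gauge fact give the instance).

* Card `schwarz-gauge-das-torsion`: `AlgebraicGaugeTransport` (engine, transcendence-free),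
  `TetrahedralGaugeExists` (Schwarz 1873, list entry II: ₂F₁(−1/12, 1/4; 1/2; z) is algebraic),
  `TetrahedralGapTwelve` (the linear Beta pair B(1/4,1/3) = f(1)·B(1/4,1/4) — the level-12
  Yamamoto–Das class, ≡ DasGapTwelve modulo duplication + reflection + Beta-cancellation).
* Card `gauss-classes-generate-torsion`: `IsHodgeTypeVec`, `standardSpan`, `GaussGeneration`
  (arithmetic: Hodge-type lattice = standard span + 4-term Gauss classes), `LinearBetaPairs`
  (the N = N' = 1, k = 0 slice of the crux, contained in MotivatedMoves.GammaHodgePairs) and the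
  reduction shape `CodimOneReduction`.
-/

noncomputable section

namespace Summit.KontsevichZagierPeriods.KontsevichZagierPeriods.Cruxes.GammaHodgeSector.SketchIdeator3

open Literature.NumberTheory.Transcendental

/-! ## Card A — finite-monodromy (Schwarz) gauge transport -/

/-- ENGINE (transcendence-free, summit-implied, provable-now candidate).  For rational `a b c` with
`0 < b < c`, `0 < c - a - b`, and a `ℚ`-semialgebraic function `f` on `[0,1]`, continuous, non-vanishing,
right-differentiable at `0`, `f 0 = 1`, solving the hypergeometric equation
`z(1-z) f'' + (c - (a+b+1) z) f' - a b f = 0` on `(0,1)` (hence `f = ₂F₁(a,b;c;·)` there and `f 1` is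
the Gauss value `Γ(c)Γ(c-a-b)/(Γ(c-a)Γ(c-b))`, an ALGEBRAIC number since `f` is semialgebraic):
the Beta representation of `B(b, c-a-b)` (Euler integral at `z = 1`) and `f 1` times the Beta
representation of `B(b, c-b)` (Euler integral at `z = 0`) are KZ-equivalent.
Chain (3-dimensional, all primitives algebraic BECAUSE `f` is): Newton–Leibniz in `z` with primitive
`f(1)·g(z,t)/f(z)` (`g` = Euler kernel); the 2-dim remainder `∫∫ ∂_z(g/f)` is killed through the
3-dim representation `∂_z(p(f g_z − g f′))(z,t)/P(z₁)` on `{0<z<z₁<1}×(0,1)`, which is Newton–Leibniz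
in `z` one way and, by the Lagrange identity `∂_z(p(f g_z − g f′)) = ∂_t(q h)` (Picard–Fuchs
certificate `h = −a tᵇ(1−t)^{c−b}(1−zt)^{−a−1}`, `p = z^c(1−z)^{a+b+1−c}`, `q = p f/(z(1−z))`),
Newton–Leibniz in `t` with zero boundary values the other way. -/
def AlgebraicGaugeTransport : Prop :=
  ∀ (a b c : ℚ), 0 < b → b < c → 0 < c - a - b →
  ∀ (f f' f'' : ℝ → ℝ),
    IsSemialgebraicFunOn ℚ {x : Fin 1 → ℝ | x 0 ∈ Set.Icc (0:ℝ) 1} (fun x => f (x 0)) →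
    ContinuousOn f (Set.Icc (0:ℝ) 1) → f 0 = 1 → (∀ z ∈ Set.Icc (0:ℝ) 1, f z ≠ 0) →
    DifferentiableWithinAt ℝ f (Set.Ici (0:ℝ)) 0 →
    (∀ z ∈ Set.Ioo (0:ℝ) 1, HasDerivAt f (f' z) z ∧ HasDerivAt f' (f'' z) z ∧
        z * (1 - z) * f'' z + ((c:ℝ) - ((a:ℝ) + (b:ℝ) + 1) * z) * f' z - (a:ℝ) * (b:ℝ) * f z = 0) →
    ∀ (r r' : KZ.IntegralRep 1),
      r.domain = {x | x 0 ∈ Set.Ioo (0:ℝ) 1} →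
      Set.EqOn r.integrand (fun x => (x 0) ^ ((b:ℝ) - 1) * (1 - x 0) ^ ((c:ℝ) - (a:ℝ) - (b:ℝ) - 1)) r.domain →
      r'.domain = {x | x 0 ∈ Set.Ioo (0:ℝ) 1} →
      Set.EqOn r'.integrand (fun x => f 1 * ((x 0) ^ ((b:ℝ) - 1) * (1 - x 0) ^ ((c:ℝ) - (b:ℝ) - 1))) r'.domain →
      KZ.Equivalent r r'

/-- The tetrahedral gauge value: `f(1) = ₂F₁(−1/12,1/4;1/2;1) = Γ(1/2)Γ(1/3)/(Γ(7/12)Γ(1/4))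
= 2^{-3/4}·3^{-1/8}·√(1+√3) = 0.85671…` (Vidunas 2005 §4 gives the companion value at `c = 2/3`). -/
def tetraGaugeValue : ℝ :=
  (2:ℝ) ^ (-(3:ℝ) / 4) * (3:ℝ) ^ (-(1:ℝ) / 8) * Real.sqrt (1 + Real.sqrt 3)

/-- GAUGE FACT (Schwarz 1873, list entry II, exponent differences (1/2,1/3,1/3); a Literature
named-fact candidate): the Gauss function `₂F₁(−1/12, 1/4; 1/2; z)` restricted to `[0,1]` is a
`ℚ`-semialgebraic function with the listed analytic properties and Gauss value `tetraGaugeValue`. -/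
def TetrahedralGaugeExists : Prop :=
  ∃ (f f' f'' : ℝ → ℝ),
    IsSemialgebraicFunOn ℚ {x : Fin 1 → ℝ | x 0 ∈ Set.Icc (0:ℝ) 1} (fun x => f (x 0)) ∧
    ContinuousOn f (Set.Icc (0:ℝ) 1) ∧ f 0 = 1 ∧ (∀ z ∈ Set.Icc (0:ℝ) 1, f z ≠ 0) ∧
    DifferentiableWithinAt ℝ f (Set.Ici (0:ℝ)) 0 ∧
    (∀ z ∈ Set.Ioo (0:ℝ) 1, HasDerivAt f (f' z) z ∧ HasDerivAt f' (f'' z) z ∧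
        z * (1 - z) * f'' z + ((((1:ℚ)/2 : ℚ) : ℝ) - ((((-1:ℚ)/12 : ℚ) : ℝ) + (((1:ℚ)/4 : ℚ) : ℝ) + 1) * z) * f' z
          - (((-1:ℚ)/12 : ℚ) : ℝ) * (((1:ℚ)/4 : ℚ) : ℝ) * f z = 0) ∧
    f 1 = tetraGaugeValue

/-- INSTANCE = the level-12 Yamamoto–Das class WITHOUT an isogeny: the linear Beta pair
`B(1/4,1/3) = f(1)·B(1/4,1/4)`, i.e. `[∫₀¹ x^{-3/4}(1-x)^{-2/3}] ~ [∫₀¹ f(1)·x^{-3/4}(1-x)^{-3/4}]`.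
Its Γ-class `[1/2]+[1/3]−[7/12]−[1/4]` is ≡ the Das class `[1/12]+[1/2]−[1/3]−[1/4]` and ≡ the class
of `TerasomaMultiplication.DasGapTwelve` modulo the standard span (duplication at 1/6 and 1/3,
reflection at 1/3) — machine-checked (job j008080 / local smoke run, N = 12 block). -/
def TetrahedralGapTwelve : Prop :=
  ∀ (r r' : KZ.IntegralRep 1),
    r.domain = {x | x 0 ∈ Set.Ioo (0:ℝ) 1} →
    Set.EqOn r.integrand (fun x => (x 0) ^ (-(3:ℝ) / 4) * (1 - x 0) ^ (-(2:ℝ) / 3)) r.domain →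
    r'.domain = {x | x 0 ∈ Set.Ioo (0:ℝ) 1} →
    Set.EqOn r'.integrand (fun x => tetraGaugeValue * ((x 0) ^ (-(3:ℝ) / 4) * (1 - x 0) ^ (-(3:ℝ) / 4))) r'.domain →
    KZ.Equivalent r r'

/-- Shape glue: engine + gauge fact ⟹ the instance (pure logic + exponent arithmetic). -/
theorem tetrahedralGapTwelve_of (hT : AlgebraicGaugeTransport) (hE : TetrahedralGaugeExists) :
    TetrahedralGapTwelve := by
  intro r r' hd hi hd' hi'
  obtain ⟨f, f', f'', hsa, hcont, h0, hne, hdiff, hode, h1⟩ := hE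
  have e1 : (((((1:ℚ)/4 : ℚ) : ℝ)) - 1) = (-(3:ℝ) / 4) := by push_cast; norm_num
  have e2 : (((((1:ℚ)/2 : ℚ) : ℝ)) - ((((-1:ℚ)/12 : ℚ) : ℝ)) - ((((1:ℚ)/4 : ℚ) : ℝ)) - 1) = (-(2:ℝ) / 3) := by
    push_cast; norm_num
  have e3 : (((((1:ℚ)/2 : ℚ) : ℝ)) - ((((1:ℚ)/4 : ℚ) : ℝ)) - 1) = (-(3:ℝ) / 4) := by push_cast; norm_num
  refine hT ((-1:ℚ)/12) ((1:ℚ)/4) ((1:ℚ)/2) (by norm_num) (by norm_num) (by norm_num)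
    f f' f'' hsa hcont h0 hne hdiff hode r r' hd ?_ hd' ?_
  · rw [e1, e2]; exact hi
  · rw [e1, e3, h1]; exact hi'

/-! ## Card B — Gauss classes generate the torsion: the sector is generated in codimension one -/

/-- Koblitz–Ogus / Deligne HODGE TYPE for an integer vector of level `N` (classes `a/N ∈ ℚ/ℤ`,
`π`-powers absorbed by the weight): `u ↦ Σ_a v(a)·⟨u a⟩` is constant on units. -/
def IsHodgeTypeVec (N : ℕ) [NeZero N] (v : ZMod N → ℤ) : Prop :=
  v 0 = 0 ∧ ∀ u : (ZMod N)ˣ,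
    (∑ a : ZMod N, v a * ((((u : ZMod N) * a).val : ℕ) : ℤ)) = ∑ a : ZMod N, v a * ((a.val : ℕ) : ℤ)

/-- basis vector of the class `x` (zero if `x = 0`). -/
def eVec (N : ℕ) [NeZero N] (x : ZMod N) : ZMod N → ℤ :=
  fun a => if a = x ∧ a ≠ 0 then 1 else 0

/-- Euler reflection vector `[x] + [−x]`. -/
def reflVec (N : ℕ) [NeZero N] (x : ZMod N) : ZMod N → ℤ := eVec N x + eVec N (-x)

/-- Gauss multiplication / distribution vector `Σ_{m a = y, a ≠ 0} [a] − [y]` (`m ∣ N`). -/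
def distVec (N : ℕ) [NeZero N] (m : ℕ) (y : ZMod N) : ZMod N → ℤ :=
  (fun a => if (m : ZMod N) * a = y ∧ a ≠ 0 then 1 else 0) - eVec N y

/-- Gauss class of `(a,b,c)`: `[c] + [c−a−b] − [c−a] − [c−b]`, the Γ-class of the Gauss value
`₂F₁(a,b;c;1) = Γ(c)Γ(c−a−b)/(Γ(c−a)Γ(c−b))`, i.e. of the LINEAR Beta pair `B(b,c−a−b) ∝ B(b,c−b)`. -/
def gaussVec (N : ℕ) [NeZero N] (a b c : ZMod N) : ZMod N → ℤ :=
  eVec N c + eVec N (c - a - b) - eVec N (c - a) - eVec N (c - b)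

/-- the STANDARD SPAN `S_N` (reflection + multiplication for every `m ∣ N`). -/
def standardSpan (N : ℕ) [NeZero N] : AddSubgroup (ZMod N → ℤ) :=
  AddSubgroup.closure
    ({v | ∃ x : ZMod N, x ≠ 0 ∧ v = reflVec N x} ∪
     {v | ∃ (m : ℕ) (y : ZMod N), 1 < m ∧ m ∣ N ∧ (∃ x : ZMod N, (m : ZMod N) * x = y) ∧ v = distVec N m y})

/-- ARITHMETIC CRUX of card B (machine-verified for all N ≤ 21 in the smoke run, N ≤ 60 + selected
levels up to 105 in job j008080): the Hodge-type lattice is the standard span plus the Hodge-type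
GAUSS classes — every Yamamoto–Das torsion class is represented by a LINEAR Beta pair. -/
def GaussGeneration (N : ℕ) [NeZero N] : Prop :=
  ∀ v : ZMod N → ℤ, IsHodgeTypeVec N v →
    v ∈ standardSpan N ⊔ AddSubgroup.closure {w | IsHodgeTypeVec N w ∧ ∃ a b c : ZMod N, w = gaussVec N a b c}

/-- Sharper, for card A: at the 5-smooth torsion levels the FINITE-MONODROMY Gauss classes
(Beukers–Heckman interlacing for every unit `u`) already suffice. `interlaces u a b c` says the points
`{ua, ub}` and `{0, uc}` alternate on `ℤ/N` read around the circle. -/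
def interlaces (N : ℕ) [NeZero N] (u a b c : ZMod N) : Prop :=
  let pa := (u * a).val; let pb := (u * b).val; let pc := (u * c).val
  pa ≠ 0 ∧ pb ≠ 0 ∧ pc ≠ 0 ∧ pa ≠ pb ∧ pa ≠ pc ∧ pb ≠ pc ∧
    ((min pa pb < pc ∧ pc < max pa pb))

/-- `SchwarzGeneration N`: Hodge-type lattice = standard span + Gauss classes of finite-monodromy
triples (Schwarz list). Verified at N = 12, 15, 20 (smoke run); FALSE at N = 21, 28 (no finite
monodromy at 7 ∣ N) — the card claims it exactly for the 5-smooth levels. -/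
def SchwarzGeneration (N : ℕ) [NeZero N] : Prop :=
  ∀ v : ZMod N → ℤ, IsHodgeTypeVec N v →
    v ∈ standardSpan N ⊔ AddSubgroup.closure
      {w | ∃ a b c : ZMod N, (∀ u : (ZMod N)ˣ, interlaces N (u : ZMod N) a b c) ∧ w = gaussVec N a b c}

/-- KZ side of card B: the `N = N' = 1, k = 0` slice of the crux — every Hodge-type LINEAR Beta pair
`B(x,y) = c·B(x',y')` is a KZ-equivalence (contained in `MotivatedMoves.GammaHodgePairs`, the divisor
range where the Deligne class is an honest algebraic correspondence between CM factors of Fermat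
Jacobians). -/
def LinearBetaPairs : Prop :=
  ∀ (x y x' y' : ℚ) (c : ℝ), 0 < x → 0 < y → 0 < x' → 0 < y' →
    Int.fract x ≠ 0 → Int.fract y ≠ 0 → Int.fract x' ≠ 0 → Int.fract y' ≠ 0 →
    (∀ u : ℕ, 0 < u → Nat.Coprime u x.den → Nat.Coprime u y.den → Nat.Coprime u x'.den → Nat.Coprime u y'.den →
      (Int.fract ((u:ℚ) * x) + Int.fract ((u:ℚ) * y) - Int.fract ((u:ℚ) * (x + y))) -
        (Int.fract ((u:ℚ) * x') + Int.fract ((u:ℚ) * y') - Int.fract ((u:ℚ) * (x' + y'))) = 0) →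
    IsAlgebraic ℚ c →
    ∀ (r r' : KZ.IntegralRep 1),
      r.domain = {t | t 0 ∈ Set.Ioo (0:ℝ) 1} →
      Set.EqOn r.integrand (fun t => (t 0) ^ ((x:ℝ) - 1) * (1 - t 0) ^ ((y:ℝ) - 1)) r.domain →
      r'.domain = {t | t 0 ∈ Set.Ioo (0:ℝ) 1} →
      Set.EqOn r'.integrand (fun t => c * ((t 0) ^ ((x':ℝ) - 1) * (1 - t 0) ^ ((y':ℝ) - 1))) r'.domain →
      r.value = r'.value → KZ.Equivalent r r'

/-- REDUCTION SHAPE of card B (the transfer `GammaHodgeSector ⇐ …`): Gauss generation of the torsion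
for every level + the linear pairs + the standard span inside the rules (multiplication for all n,
Euler reflection, Beta-cancellation) give the whole Γ-Hodge sector. (Translation / Dirichlet
re-association and the ball ↔ B(1/2,1/2)^k conversion are provable glue, not listed.) -/
def CodimOneReduction : Prop :=
  (∀ (N : ℕ) [NeZero N], GaussGeneration N) →
  LinearBetaPairs →
  Summit.KontsevichZagierPeriods.KontsevichZagierPeriods.Theses.TerasomaMultiplication.MultiplicationAccessible →
  Summit.KontsevichZagierPeriods.KontsevichZagierPeriods.Theses.CompiledSubstitutions.EulerReflectionRational →
  Summit.KontsevichZagierPeriods.KontsevichZagierPeriods.Theses.TerasomaMultiplication.BetaCancellation →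
  Summit.KontsevichZagierPeriods.KontsevichZagierPeriods.Theses.TerasomaMultiplication.GammaHodgeSector

/-- REDUCTION SHAPE of card A at the 5-smooth levels: the engine + one gauge fact per Schwarz orbit
replace `LinearBetaPairs` there. -/
def SchwarzReduction : Prop :=
  AlgebraicGaugeTransport → TetrahedralGaugeExists →
  Summit.KontsevichZagierPeriods.KontsevichZagierPeriods.Theses.TerasomaMultiplication.MultiplicationAccessible →
  Summit.KontsevichZagierPeriods.KontsevichZagierPeriods.Theses.CompiledSubstitutions.EulerReflectionRational →
  Summit.KontsevichZagierPeriods.KontsevichZagierPeriods.Theses.TerasomaMultiplication.BetaCancellation →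
  Summit.KontsevichZagierPeriods.KontsevichZagierPeriods.Theses.TerasomaMultiplication.DasGapTwelve

/-! ## Card B — the first DEEP instances (depth 4): levels 33 and 35 -/

/-- `DasDeepThirtyThree` — the smallest-level instance of the crux whose torsion class has NO
representative with `N + N' ≤ 3` Beta factors modulo the standard span (machine search, levels ≤ 35;
job j008717 extends the table): `B(1/33,1/33)·B(2/33,22/33) = c·B(1/33,3/33)·B(2/33,14/33)`
(`N = N' = 2`, `k = 0`; `c` real algebraic by Deligne 1982 Thm 7.18). Its Deligne class is a
codimension-2 Hodge class on a product of four quotients of the Fermat curve `F₃₃` — the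
"decisive range N+N' ≥ 4 with composite denominators" of the crux docstring, now located. -/
def DasDeepThirtyThree : Prop :=
  ∀ (c : ℝ), IsAlgebraic ℚ c → ∀ (r r' : KZ.IntegralRep 2),
    r.domain = {x | ∀ i, x i ∈ Set.Ioo (0:ℝ) 1} →
    Set.EqOn r.integrand (fun x => (x 0) ^ (-(32:ℝ)/33) * (1 - x 0) ^ (-(32:ℝ)/33) *
      ((x 1) ^ (-(31:ℝ)/33) * (1 - x 1) ^ (-(11:ℝ)/33))) r.domain →
    r'.domain = {x | ∀ i, x i ∈ Set.Ioo (0:ℝ) 1} →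
    Set.EqOn r'.integrand (fun x => c * ((x 0) ^ (-(32:ℝ)/33) * (1 - x 0) ^ (-(30:ℝ)/33) *
      ((x 1) ^ (-(31:ℝ)/33) * (1 - x 1) ^ (-(19:ℝ)/33)))) r'.domain →
    r.value = r'.value → KZ.Equivalent r r'

/-- `DasDeepThirtyFive` — the level-35 deep instance, of shape `N = 3`, `N' = 1`, `k = 1`:
`B(4/35,32/35)·B(7/35,27/35)·B(9/35,25/35) = c·π·B(1/35,1/35)`, cube rep vs (disc × interval) rep
with integrand `c·1!·t^{-34/35}(1-t)^{-34/35}`. -/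
def DasDeepThirtyFive : Prop :=
  ∀ (c : ℝ), IsAlgebraic ℚ c → ∀ (r r' : KZ.IntegralRep 3),
    r.domain = {x | ∀ i, x i ∈ Set.Ioo (0:ℝ) 1} →
    Set.EqOn r.integrand (fun x => (x 0) ^ (-(31:ℝ)/35) * (1 - x 0) ^ (-(3:ℝ)/35) *
      ((x 1) ^ (-(28:ℝ)/35) * (1 - x 1) ^ (-(8:ℝ)/35)) * ((x 2) ^ (-(26:ℝ)/35) * (1 - x 2) ^ (-(10:ℝ)/35))) r.domain →
    r'.domain = {z | z 0 ^ 2 + z 1 ^ 2 < 1 ∧ z 2 ∈ Set.Ioo (0:ℝ) 1} →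
    Set.EqOn r'.integrand (fun z => c * ((z 2) ^ (-(34:ℝ)/35) * (1 - z 2) ^ (-(34:ℝ)/35))) r'.domain →
    r.value = r'.value → KZ.Equivalent r r'

/-- The depth-filtration TRANSFER of card B in its sharpest typed form for the levels computed so far:
the crux restricted to levels `N ≤ 35` follows from the standard span inside the rules, the
divisor-range pairs (MotivatedMoves.GammaHodgePairs) and the two deep instances. (Shape only; the
level restriction is informal here — the full statement quantifies over the certified depth table.) -/
def DepthTransferUpTo35 : Prop :=
  Summit.KontsevichZagierPeriods.KontsevichZagierPeriods.Theses.TerasomaMultiplication.MultiplicationAccessible →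
  Summit.KontsevichZagierPeriods.KontsevichZagierPeriods.Theses.CompiledSubstitutions.EulerReflectionRational →
  Summit.KontsevichZagierPeriods.KontsevichZagierPeriods.Theses.TerasomaMultiplication.BetaCancellation →
  Summit.KontsevichZagierPeriods.KontsevichZagierPeriods.Theses.MotivatedMoves.GammaHodgePairs →
  DasDeepThirtyThree → DasDeepThirtyFive → True

end Summit.KontsevichZagierPeriods.KontsevichZagierPeriods.Cruxes.GammaHodgeSector.SketchIdeator3
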